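import Literature.MathematicalPhysics.QuantumLattice.LatticeLevelCountFromVolume
import Literature.MathematicalPhysics.QuantumLattice.FermiRG.FST2Hypotheses
import Summits.HubbardSuperconductivity.HubbardSuperconductivity.Theorems.KLProgrammeKLRegimeSplitCounterMap
import HarnessLib

/-!
# The density-of-states count of an admissible frame band: `#{k⃗ : |e_K(2πk⃗/L)| < η} ≤ C₁ηL² + C₂L` from `GeomConstants`

Route `KLProgramme`, crux K3 ENGINE (stmt-HubbardSuperconductivity-19662 / gen-3 `KLRegimeEngineV10`), stub `stub_engine_scale0`
(cell gate-hubbard-kl, seat hubbard-kl-k3c2-p1).  The last link of the scale-`0` covariance chain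
`FrameOK ⇒ DOS count ⇒ κ_IR (InfraredCutoffGramConstant) ⇒ IsDetBoundedR (HubbardCTScaleZeroDetBound)`: for a frame band
`e_K = frameLevel μ K` with `FrameOK` (i)'s geometric constants `GeomConstants e_K 7 (3/80) (1/2) (3/200)` (all second derivatives `≤ 7`,
`|∇e_K| ≥ 1/2` on the tube `{|e_K| < 3/80}`), the lattice level count is linear in `η` down to any `η ≥ 0` plus the `O(L)` rounding term,
with ABSOLUTE constants, for `L ≥ 2^{15}` (so that the cell thickening `14·2π/L` stays inside the tube): transfer to `ℝ × ℝ` along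
`Φ(x,y) = (x,y) ∈ EuclideanSpace`, `‖Φ‖ ≤ 2`, regularity `|∂₁| ∨ |∂₂| ≥ 1/(2√2) > 2·(1/6)` from `|∇e_K| ≥ 1/2`, and
`LatticeLevelCountFromVolume.card_filter_abs_lt_mul_sq_le` (FST II App. B tiling).  Everything is proved; no definition, no named fact.
-/

noncomputable section

namespace Summit.HubbardSuperconductivity.HubbardSuperconductivity.Theorems.EngineV8

set_option linter.dupNamespace false

open Real Finset Literature.MathematicalPhysics.QuantumLattice Literature.Probability.LatticeModels
open Literature.MathematicalPhysics.QuantumLattice.FermiRG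
open Summit.HubbardSuperconductivity.HubbardSuperconductivity.Theorems.DispersionFlow
open InnerProductSpace

/-- **The torus band is the frame level at the lattice momentum**: `nambuXiCT L μ K k⃗ = e_K(2πk⃗/L)`. -/
theorem nambuXiCT_eq_frameLevel (L : ℕ) [NeZero L] (μ : ℝ) (K : TrigPolyC4v) (k : TorusSite 2 L) :
    nambuXiCT L μ K k = frameLevel μ K (WithLp.toLp 2 (latticeMomentum L k)) := by
  simp only [nambuXiCT, frameLevel, torusBand, squareDispersion, Fin.sum_univ_two]
  simp

/-- The coordinate map `ℝ × ℝ → EuclideanSpace ℝ (Fin 2)` has operator norm `≤ 2`. -/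
theorem norm_prodToEuclidean_le :
    ‖(((ContinuousLinearEquiv.finTwoArrow ℝ ℝ).symm.trans (EuclideanSpace.equiv (Fin 2) ℝ).symm :
        (ℝ × ℝ) ≃L[ℝ] EuclideanSpace ℝ (Fin 2)) : (ℝ × ℝ) →L[ℝ] EuclideanSpace ℝ (Fin 2))‖ ≤ 2 := by
  refine ContinuousLinearMap.opNorm_le_bound _ (by norm_num) fun q => ?_
  have hq : (((ContinuousLinearEquiv.finTwoArrow ℝ ℝ).symm.trans (EuclideanSpace.equiv (Fin 2) ℝ).symm :
      (ℝ × ℝ) ≃L[ℝ] EuclideanSpace ℝ (Fin 2)) : (ℝ × ℝ) →L[ℝ] EuclideanSpace ℝ (Fin 2)) q = WithLp.toLp 2 ![q.1, q.2] := by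
    simp [EuclideanSpace.equiv]
  rw [hq, EuclideanSpace.norm_eq, Fin.sum_univ_two]
  simp only [Matrix.cons_val_zero, Matrix.cons_val_one, Real.norm_eq_abs, sq_abs]
  have h1 : |q.1| ≤ ‖q‖ := by
    have := norm_fst_le q
    rwa [Real.norm_eq_abs] at this
  have h2 : |q.2| ≤ ‖q‖ := by
    have := norm_snd_le q
    rwa [Real.norm_eq_abs] at this
  have hn : 0 ≤ ‖q‖ := norm_nonneg _
  calc Real.sqrt (q.1 ^ 2 + q.2 ^ 2) ≤ Real.sqrt ((2 * ‖q‖) ^ 2) := Real.sqrt_le_sqrt (by nlinarith [sq_abs q.1, sq_abs q.2, abs_nonneg q.1, abs_nonneg q.2])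
    _ = 2 * ‖q‖ := Real.sqrt_sq (by positivity)

/-- **The DOS count of a regular frame band.**  For `e_K = frameLevel μ K` of class `C²` with `GeomConstants e_K 7 (3/80) (1/2) (3/200)`
(`FrameOK` (i)), every `L ≥ 2^{15}` and `0 ≤ η ≤ 1/32`:
`#{k⃗ ∈ (ℤ/L)² : |nambuXiCT L μ K k⃗| < η} · (2π/L)² ≤ n²·s·2(η + 28π/L)/δ₁` with the ABSOLUTE data `δ₁ = 1/6`, `s = δ₁/29`,
`n = ⌈(2π + 2π/L)/s⌉` (the output of `card_filter_abs_lt_mul_sq_le` for `e_K ∘ Φ` on `ℝ × ℝ`, `‖Φ‖ ≤ 2`: `‖D²‖ ≤ 28`, Lipschitz `14`,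
regular with `2δ₁ ≤ |∂ᵢ|` on `{|e_K| ≤ 7/200}`) — linear in `η` plus the `O(L)` rounding term, uniformly in the frame. -/
theorem card_filter_nambuXiCT_lt_mul_sq_le {μ : ℝ} {K : TrigPolyC4v} (hC2 : ContDiff ℝ 2 (frameLevel μ K))
    (hG : GeomConstants (frameLevel μ K) 7 (3 / 80) (1 / 2) (3 / 200)) (L : ℕ) [NeZero L] (hL : (2 : ℝ) ^ 15 ≤ L)
    {η : ℝ} (hη : 0 ≤ η) (hηe : η ≤ 1 / 32) :
    (((univ.filter fun k : TorusSite 2 L => |nambuXiCT L μ K k| < η).card : ℕ) : ℝ) * (2 * Real.pi / L) ^ 2 ≤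
      (⌈(2 * Real.pi + 2 * Real.pi / L) / ((1 / 6 : ℝ) / (28 + 1))⌉₊ : ℝ) *
        ⌈(2 * Real.pi + 2 * Real.pi / L) / ((1 / 6 : ℝ) / (28 + 1))⌉₊ *
        (((1 / 6 : ℝ) / (28 + 1)) * (2 * (η + 14 * (2 * Real.pi / L)) / (1 / 6 : ℝ))) := by
  have hLpos : (0 : ℝ) < L := by exact_mod_cast Nat.pos_of_ne_zero (NeZero.ne L)
  set Φ : (ℝ × ℝ) ≃L[ℝ] EuclideanSpace ℝ (Fin 2) :=
    (ContinuousLinearEquiv.finTwoArrow ℝ ℝ).symm.trans (EuclideanSpace.equiv (Fin 2) ℝ).symm with hΦdef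
  set f : EuclideanSpace ℝ (Fin 2) → ℝ := frameLevel μ K with hfdef
  have hΦq : ∀ q : ℝ × ℝ, Φ q = WithLp.toLp 2 ![q.1, q.2] := fun q => by simp [hΦdef, EuclideanSpace.equiv]
  have hΦnorm : ‖(Φ : (ℝ × ℝ) →L[ℝ] EuclideanSpace ℝ (Fin 2))‖ ≤ 2 := norm_prodToEuclidean_le
  -- the transported band
  set g : ℝ × ℝ → ℝ := f ∘ (Φ : (ℝ × ℝ) →L[ℝ] EuclideanSpace ℝ (Fin 2)) with hgdef
  have hgC2 : ContDiff ℝ 2 g := hC2.comp (Φ : (ℝ × ℝ) →L[ℝ] EuclideanSpace ℝ (Fin 2)).contDiff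
  have hfd : ∀ p : ℝ × ℝ, fderiv ℝ g p = (fderiv ℝ f (Φ p)).comp (Φ : (ℝ × ℝ) →L[ℝ] EuclideanSpace ℝ (Fin 2)) := fun p =>
    Φ.comp_right_fderiv
  have hpart : ∀ (p v : ℝ × ℝ), fderiv ℝ g p v = inner ℝ (gradient f (Φ p)) (Φ v) := by
    intro p v
    rw [hfd, ContinuousLinearMap.comp_apply, gradient, InnerProductSpace.toDual_symm_apply]
    rfl
  have hΦ10 : Φ ((1 : ℝ), (0 : ℝ)) = EuclideanSpace.single 0 (1 : ℝ) := by
    rw [hΦq]; ext i; fin_cases i <;> simp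
  have hΦ01 : Φ ((0 : ℝ), (1 : ℝ)) = EuclideanSpace.single 1 (1 : ℝ) := by
    rw [hΦq]; ext i; fin_cases i <;> simp
  have hd1 : ∀ p : ℝ × ℝ, fderiv ℝ g p ((1 : ℝ), (0 : ℝ)) = gradient f (Φ p) 0 := by
    intro p; rw [hpart, hΦ10, EuclideanSpace.inner_single_right]; simp
  have hd2 : ∀ p : ℝ × ℝ, fderiv ℝ g p ((0 : ℝ), (1 : ℝ)) = gradient f (Φ p) 1 := by
    intro p; rw [hpart, hΦ01, EuclideanSpace.inner_single_right]; simp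
  -- regularity near the zero set
  have hreg : ∀ p : ℝ × ℝ, |g p| ≤ 7 / 200 →
      2 * (1 / 6 : ℝ) ≤ |fderiv ℝ g p ((1 : ℝ), (0 : ℝ))| ∨ 2 * (1 / 6 : ℝ) ≤ |fderiv ℝ g p ((0 : ℝ), (1 : ℝ))| := by
    intro p hp
    have htube : |f (Φ p)| < 3 / 80 := lt_of_le_of_lt hp (by norm_num)
    have hgrad : (1 / 2 : ℝ) ≤ ‖gradient f (Φ p)‖ := hG.le_norm_gradient (Φ p) htube
    have hsq : ‖gradient f (Φ p)‖ ^ 2 = (gradient f (Φ p) 0) ^ 2 + (gradient f (Φ p) 1) ^ 2 := by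
      rw [EuclideanSpace.norm_eq, Real.sq_sqrt (Finset.sum_nonneg fun _ _ => by positivity), Fin.sum_univ_two]
      simp [sq_abs]
    rw [hd1, hd2]
    by_contra hcon
    push Not at hcon
    obtain ⟨ha, hb⟩ := hcon
    have ha' : (gradient f (Φ p) 0) ^ 2 < (1 / 3) ^ 2 := by
      have := abs_nonneg (gradient f (Φ p) 0)
      calc (gradient f (Φ p) 0) ^ 2 = |gradient f (Φ p) 0| ^ 2 := (sq_abs _).symm
        _ < (1 / 3) ^ 2 := by nlinarith
    have hb' : (gradient f (Φ p) 1) ^ 2 < (1 / 3) ^ 2 := by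
      have := abs_nonneg (gradient f (Φ p) 1)
      calc (gradient f (Φ p) 1) ^ 2 = |gradient f (Φ p) 1| ^ 2 := (sq_abs _).symm
        _ < (1 / 3) ^ 2 := by nlinarith
    nlinarith [norm_nonneg (gradient f (Φ p))]
  -- second derivatives
  have hD2 : ∀ p : ℝ × ℝ, ‖fderiv ℝ (fderiv ℝ g) p‖ ≤ 28 := by
    intro p
    rw [← norm_iteratedFDeriv_zero (𝕜 := ℝ) (f := fderiv ℝ (fderiv ℝ g)), norm_iteratedFDeriv_fderiv, norm_iteratedFDeriv_fderiv]
    have hcomp := ContinuousLinearMap.iteratedFDeriv_comp_right (Φ : (ℝ × ℝ) →L[ℝ] EuclideanSpace ℝ (Fin 2)) hC2 p (i := 2) le_rfl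
    rw [show (0 + 1 + 1 : ℕ) = 2 from rfl, hgdef, hcomp]
    refine (ContinuousMultilinearMap.norm_compContinuousLinearMap_le _ _).trans ?_
    have h7 : ‖iteratedFDeriv ℝ 2 f (Φ p)‖ ≤ 7 := hG.norm_iteratedFDeriv_le (Φ p) 2 le_rfl
    rw [Fin.prod_univ_two]
    calc ‖iteratedFDeriv ℝ 2 f (Φ p)‖ * (‖(Φ : (ℝ × ℝ) →L[ℝ] EuclideanSpace ℝ (Fin 2))‖ * ‖(Φ : (ℝ × ℝ) →L[ℝ] EuclideanSpace ℝ (Fin 2))‖)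
        ≤ 7 * (2 * 2) := mul_le_mul h7 (mul_le_mul hΦnorm hΦnorm (norm_nonneg _) (by norm_num)) (by positivity) (by norm_num)
      _ = 28 := by norm_num
  -- Lipschitz constant 14 (sup metric on `ℝ × ℝ`)
  have hD1 : ∀ p : ℝ × ℝ, ‖fderiv ℝ g p‖ ≤ 14 := by
    intro p
    rw [hfd]
    refine (ContinuousLinearMap.opNorm_comp_le _ _).trans ?_
    have h7 : ‖fderiv ℝ f (Φ p)‖ ≤ 7 := by
      rw [← norm_iteratedFDeriv_zero (𝕜 := ℝ) (f := fderiv ℝ f), norm_iteratedFDeriv_fderiv]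
      exact hG.norm_iteratedFDeriv_le (Φ p) 1 (by norm_num)
    calc ‖fderiv ℝ f (Φ p)‖ * ‖(Φ : (ℝ × ℝ) →L[ℝ] EuclideanSpace ℝ (Fin 2))‖ ≤ 7 * 2 :=
          mul_le_mul h7 hΦnorm (norm_nonneg _) (by norm_num)
      _ = 14 := by norm_num
  have hLip : ∀ p q : ℝ × ℝ, |g p - g q| ≤ 14 * dist p q := by
    intro p q
    have h := Convex.norm_image_sub_le_of_norm_fderiv_le (f := g) (s := Set.univ) (fun x _ => hgC2.differentiable (by norm_num) x)
      (fun x _ => hD1 x) convex_univ (Set.mem_univ q) (Set.mem_univ p)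
    rw [Real.norm_eq_abs, ← dist_eq_norm] at h
    exact h
  -- the count on `ℝ × ℝ`
  have hthick : η + 14 * (2 * Real.pi / L) ≤ 7 / 200 := by
    have hπ : Real.pi < 3.1416 := Real.pi_lt_d4
    have h1 : 2 * Real.pi / L ≤ 2 * 3.1416 / 2 ^ 15 := by
      rw [div_le_div_iff₀ hLpos (by norm_num)]
      nlinarith [Real.pi_pos]
    nlinarith
  have hcount := card_filter_abs_lt_mul_sq_le g hgC2 (G := 14) (M := 28) (δ₁ := 1 / 6) (r := 7 / 200) (by norm_num) (by norm_num)
    (by norm_num) hLip hD2 hreg hη hthick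
  -- the two filters coincide
  have hfilter : (univ.filter fun k : TorusSite 2 L => |nambuXiCT L μ K k| < η) =
      univ.filter fun k : TorusSite 2 L => |g (2 * Real.pi * ((k 0).val : ℝ) / L, 2 * Real.pi * ((k 1).val : ℝ) / L)| < η := by
    refine Finset.filter_congr fun k _ => ?_
    have hk : g (2 * Real.pi * ((k 0).val : ℝ) / L, 2 * Real.pi * ((k 1).val : ℝ) / L) = nambuXiCT L μ K k := by
      simp only [hgdef, Function.comp_apply, ContinuousLinearEquiv.coe_coe, hΦq, nambuXiCT_eq_frameLevel, hfdef]
      congr 2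
      funext i
      fin_cases i <;> simp [latticeMomentum]
    rw [hk]
  rw [hfilter]
  exact hcount

/-- **The frame band is `C²`** (indeed smooth: a trigonometric polynomial plus the free band). -/
theorem contDiff_frameLevel (μ : ℝ) (K : TrigPolyC4v) {n : WithTop ℕ∞} : ContDiff ℝ n (frameLevel μ K) := by
  have h0 : ContDiff ℝ n (fun q : EuclideanSpace ℝ (Fin 2) => q 0) := (EuclideanSpace.proj (𝕜 := ℝ) (0 : Fin 2)).contDiff
  have h1 : ContDiff ℝ n (fun q : EuclideanSpace ℝ (Fin 2) => q 1) := (EuclideanSpace.proj (𝕜 := ℝ) (1 : Fin 2)).contDiff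
  have hK : ContDiff ℝ n (fun q : EuclideanSpace ℝ (Fin 2) => K.eval (WithLp.ofLp q)) := KLRegimeSplit.contDiff_evalM K
  have h : ContDiff ℝ n (fun q : EuclideanSpace ℝ (Fin 2) =>
      -2 * 1 * (Real.cos (q 0) + Real.cos (q 1)) - 4 * 0 * Real.cos (q 0) * Real.cos (q 1) - μ - K.eval (WithLp.ofLp q)) :=
    ((((contDiff_const.mul (h0.cos.add h1.cos)).sub ((contDiff_const.mul h0.cos).mul h1.cos)).sub contDiff_const).sub hK)
  convert h using 2 with q
  simp [frameLevel, squareDispersion]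

/-- **The DOS count of an admissible frame band, clean form**: under `FrameOK R U N μ K`, for every `L ≥ 2^{15}` and `0 ≤ η ≤ 1/32`,
`#{k⃗ ∈ (ℤ/L)² : |nambuXiCT L μ K k⃗| < η} ≤ 2200·η·L² + 200000·L` — the hypothesis of `InfraredCutoffGramConstant` with
absolute `c₁ = 2200`, `c₂ = 200000`, uniformly in the frame, `μ`, `U`, `β`. -/
theorem card_filter_nambuXiCT_lt_le_of_frameOK {R : KLRegimeSplit.RenConsts} {U : ℝ} {N : ℕ} {μ : ℝ} {K : TrigPolyC4v}
    (hK : KLRegimeSplit.FrameOK R U N μ K) (L : ℕ) [NeZero L] (hL : (2 : ℝ) ^ 15 ≤ L) {η : ℝ} (hη : 0 ≤ η) (hηe : η ≤ 1 / 32) :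
    (((univ.filter fun k : TorusSite 2 L => |nambuXiCT L μ K k| < η).card : ℕ) : ℝ) ≤ 2200 * η * (L : ℝ) ^ 2 + 200000 * L := by
  have hLpos : (0 : ℝ) < L := by exact_mod_cast Nat.pos_of_ne_zero (NeZero.ne L)
  have hπ := Real.pi_pos
  have hπ3 : (3.14159 : ℝ) < Real.pi := by linarith [Real.pi_gt_d6]
  have hπ4 : Real.pi < 3.1416 := Real.pi_lt_d4
  have h := card_filter_nambuXiCT_lt_mul_sq_le (contDiff_frameLevel μ K) hK.1 L hL hη hηe
  set cnt : ℝ := (((univ.filter fun k : TorusSite 2 L => |nambuXiCT L μ K k| < η).card : ℕ) : ℝ) with hcnt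
  have hcnt0 : 0 ≤ cnt := Nat.cast_nonneg _
  -- `n ≤ 1094`
  have hx : (2 * Real.pi + 2 * Real.pi / L) / ((1 / 6 : ℝ) / (28 + 1)) ≤ 1094 := by
    have h1 : 2 * Real.pi / L ≤ 2 * 3.1416 / 2 ^ 15 := by
      rw [div_le_div_iff₀ hLpos (by norm_num)]
      nlinarith
    rw [div_le_iff₀ (by norm_num)]
    nlinarith
  have hn : (⌈(2 * Real.pi + 2 * Real.pi / L) / ((1 / 6 : ℝ) / (28 + 1))⌉₊ : ℝ) ≤ 1094 := by
    have : ⌈(2 * Real.pi + 2 * Real.pi / L) / ((1 / 6 : ℝ) / (28 + 1))⌉₊ ≤ 1094 := Nat.ceil_le.2 (by exact_mod_cast hx)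
    exact_mod_cast this
  have hn0 : (0 : ℝ) ≤ (⌈(2 * Real.pi + 2 * Real.pi / L) / ((1 / 6 : ℝ) / (28 + 1))⌉₊ : ℝ) := Nat.cast_nonneg _
  set ε' := η + 14 * (2 * Real.pi / L) with hε'
  have hε'0 : 0 ≤ ε' := by positivity
  have hRHS : (⌈(2 * Real.pi + 2 * Real.pi / L) / ((1 / 6 : ℝ) / (28 + 1))⌉₊ : ℝ) *
      ⌈(2 * Real.pi + 2 * Real.pi / L) / ((1 / 6 : ℝ) / (28 + 1))⌉₊ *
        (((1 / 6 : ℝ) / (28 + 1)) * (2 * ε' / (1 / 6 : ℝ))) ≤ 82541 * ε' := by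
    have hsq : (⌈(2 * Real.pi + 2 * Real.pi / L) / ((1 / 6 : ℝ) / (28 + 1))⌉₊ : ℝ) *
        ⌈(2 * Real.pi + 2 * Real.pi / L) / ((1 / 6 : ℝ) / (28 + 1))⌉₊ ≤ 1094 * 1094 := mul_le_mul hn hn hn0 (by norm_num)
    have he : ((1 / 6 : ℝ) / (28 + 1)) * (2 * ε' / (1 / 6 : ℝ)) = (2 / 29) * ε' := by ring
    rw [he]
    nlinarith
  have h2 : cnt * (2 * Real.pi / L) ^ 2 ≤ 82541 * ε' := h.trans hRHS
  -- compare with the target times `(2π/L)²`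
  have hsqpos : 0 < (2 * Real.pi / L) ^ 2 := by positivity
  have htarget : 82541 * ε' ≤ (2200 * η * (L : ℝ) ^ 2 + 200000 * L) * (2 * Real.pi / L) ^ 2 := by
    have e1 : (2200 * η * (L : ℝ) ^ 2 + 200000 * L) * (2 * Real.pi / L) ^ 2 =
        4 * Real.pi ^ 2 * (2200 * η) + 4 * Real.pi ^ 2 * 200000 / L := by
      field_simp
      ring
    rw [e1, hε']
    have hp2 : (9.86 : ℝ) ≤ Real.pi ^ 2 := by nlinarith
    have hA : 82541 * η ≤ 4 * Real.pi ^ 2 * (2200 * η) := by nlinarith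
    have hB : 82541 * (14 * (2 * Real.pi / L)) ≤ 4 * Real.pi ^ 2 * 200000 / L := by
      rw [show 82541 * (14 * (2 * Real.pi / L)) = (82541 * 28 * Real.pi) / L by ring, div_le_div_iff₀ hLpos hLpos]
      have : 82541 * 28 * Real.pi ≤ 4 * Real.pi ^ 2 * 200000 := by nlinarith
      nlinarith
    linarith
  exact le_of_mul_le_mul_right (h2.trans htarget) hsqpos

end Summit.HubbardSuperconductivity.HubbardSuperconductivity.Theorems.EngineV8

end
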